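import Summits.BirchSwinnertonDyer.BirchSwinnertonDyer.Theorems.ThetaPartnerAtTwoSignedKatoUpToAtTwoKatoBKBricks
import HarnessLib

/-!
# Route `ThetaPartnerAtTwo` (TP2), crux K3 `SignedKatoDivisibilityUpToAtTwo` (stmt-BirchSwinnertonDyer-20308 / K3P′ 25631), line `colemanrat`
# v14.1 — Λ-FREE TWINS I: Kato's constant is rational, and brick B4c (trivial-character values at levels `4, 8`), from the VALUE LAW (C5)
# ALONE — no classes `z`, no dual-exponential datum `Λ`, no Tate-module structure binders

Width seat `bsd-wall-tp2-p2x-w2` g8 (cell `bsd-wall`).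

* §1 `KatoConst.value_level_one_of_valueLaw`, `KatoConst.exists_ratCast_eq_katoConstant_of_valueLaw` (+ `_of_analyticRank_eq_zero_of_valueLaw`)
  — twins of w4 g0's `KatoConst.exists_ratCast_eq_katoConstant` (`…KatoConstantRational`): `κ ∈ ℚ` from the (C5)-FAMILY `∀ (c d a A), ∃ x, (C5)`.
* §2 `KatoValue.sum_sigma_eq_of_valueLaw` — twin of w4 g0's `KatoValue.sum_sigma_eq_of_zetaBody` (`…KatoTrivialCharValues`).
* §3 `KatoBK.katoTrivialValuesTwo_brick_of_valueLaw` — twin of the lead's socket brick `KatoBK.katoTrivialValuesTwo_brick` (`…KatoBKBricks`), i.e.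
  the displayed hypothesis `hB4c` of a Λ-free socket, DISCHARGED.

AUDIT behind this file (of w3 g8's socket `KatoBK.corePairChiPrim_of_coreKZ_of_bricks`, p636266 = the lead's p635470 re-cut): of the six conjuncts
of `Kato2004.ZetaBody W 2 f ιC κK ΛK c d a A z x` the socket consumes (C1) and (C2) (through `Kato2004.exists_isEulerSystemClassTwo_of_zetaBody`)
and (C5) (through `KatoConst.exists_ratCast_eq_katoConstant_of_analyticRank_eq_zero` — whose call of `zetaBody_value_level_one` DISCARDS the
`Λ`-clause —, `KatoBK.charSumF_mul_gaussSum_eq_two` = w4 g0's `KatoValue.charSumF_mul_gaussSum_eq`, and brick B4c = w4 g0's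
`KatoValue.sum_sigma_eq_of_zetaBody`), never (C3a) (`Λ` Galois-equivariant), (C3b) (`Λ` local at `p`) or (C4) (`Λ(z) = 1 ⊗ x`). So Kato's
ABSTRACT dual-exponential datum `Λ` — whose axioms (C3a)/(C3b) are READINGS of Kato §9.4 carried «with their own attribution» inside the fact
shape (module docstring of `Literature/…/Kato2004/EulerSystemValues.lean`, O1 / X1-eq / X1-loc) — is IDLE in the displayed residue CORE_KZ once
the Bloch–Kato clause (KZ) ties `x` to `z` through the layer pairing. The three files `…KatoBKLambdaFree{Values,CharValues,ESClass}.lean`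
supply the Λ-free inputs of a re-cut socket over CORE_KZ⁰ (= CORE_KZ with «∃ ΛK … ZetaBody … ∧ (KZ)» replaced by «(C1) ∧ (C2) ∧ (C5) ∧ (KZ)»).
The displayed hypothesis `hC5` is VERBATIM conjunct (C5) of `ZetaBody` with its `let` expanded (definitional check:
`KatoValue.valueLaw_of_zetaBody` in `…LambdaFreeCharValues`). Proofs are the originals' proofs with the destructuring of `hbody` removed.
HONEST FRAMING: theorems only (no definition, no named fact, no instance, no `sorry`); every statement is CONDITIONAL on displayed Kato-shaped
hypotheses (conjuncts of the conclusion of the cite-only fact `Kato2004.exists_eulerSystem_expStar_values`); closes no item; K3 / K3P′ are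
NOT settled and BSD is NOT proved by any of this.

References: K. Kato, Astérisque 295 (2004), Ex. 13.3 (p. 225), (8.1.3) (p. 180), Lemma 8.5 (pp. 183–184), §6.2 (p. 161), Thm. 6.6 (1)
(p. 163), Thm. 9.7 (p. 189), §13.1 and Thm. 13.4 (pp. 224–226) [Kato2004Asterisque]; B. Mazur, J. Tate, J. Teitelbaum, Invent. Math. 84
(1986) §I.8 [MazurTateTeitelbaum1986Invent]; L. Washington, *Introduction to Cyclotomic Fields* (1997) §13.1 [Washington1997].
-/

set_option autoImplicit false
-- the Theorems namespace of this sub repeats the summit name by design (D-0017 nested layout)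
set_option linter.dupNamespace false

noncomputable section

set_option backward.isDefEq.respectTransparency false

open scoped BigOperators NumberField TensorProduct MatrixGroups Real

open CongruenceSubgroup Complex WeierstrassCurve Field IsDedekindDomain NumberField
  Literature.NumberTheory.GaloisRepresentations
  Literature.NumberTheory.EllipticCurves Literature.NumberTheory.EllipticCurves.ModularForms
  Literature.NumberTheory.EllipticCurves.Rank1Residual
  Literature.NumberTheory.EllipticCurves.Kato2004 Literature.NumberTheory.EllipticCurves.Kato2004.EulerSystemValues
  Rat.HeightOneSpectrum

namespace Summit.BirchSwinnertonDyer.BirchSwinnertonDyer.Theorems.SignedKatoOffTwo.KatoConst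

variable {W : WeierstrassCurve ℚ} [W.IsElliptic] {N : ℕ} [NeZero N] {f : CuspForm (Gamma0 N) 2}

/-! ## §1 Kato's constant is rational — from the (C5)-family alone -/

/-- The bottom cyclotomic level is `m(0, ∅) = 1` (local copy of the private lemma of `Kato2004/EulerSystemClassNonvanishingProofs`). [folklore] -/
private theorem cycLevel_zero_empty' (p : ℕ) : cycLevel p 0 ∅ = 1 := by
  simp [cycLevel]

/-- Every element of `ℚ(ζ_1)` is rational (`φ(1) = 1`; local copy). [folklore] -/
private theorem exists_algebraMap_eq_of_level_one' {m : ℕ} [NeZero m] (hm : m = 1)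
    (y : CyclotomicField m ℚ) : ∃ r : ℚ, algebraMap ℚ (CyclotomicField m ℚ) r = y := by
  have hfin : Module.finrank ℚ (CyclotomicField m ℚ) = 1 := by
    rw [IsCyclotomicExtension.finrank (CyclotomicField m ℚ)
      (Polynomial.cyclotomic.irreducible_rat (NeZero.pos m)), hm, Nat.totient_one]
  have hy : y ∈ (⊥ : Subalgebra ℚ (CyclotomicField m ℚ)) := by
    rw [Subalgebra.bot_eq_top_of_finrank_eq_one hfin]
    exact Algebra.mem_top
  exact Algebra.mem_bot.mp hy

/-- A ring homomorphism `ℚ(ζ_m) → ℂ` restricts to the canonical map on `ℚ` (local copy). [folklore] -/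
private theorem ringHom_algebraMap_ratCast' {m : ℕ} [NeZero m] (ι : CyclotomicField m ℚ →+* ℂ) (r : ℚ) :
    ι (algebraMap ℚ (CyclotomicField m ℚ) r) = (r : ℂ) := by
  rw [← RingHom.comp_apply]
  exact congrFun (congrArg DFunLike.coe (Subsingleton.elim (ι.comp (algebraMap ℚ _)) (Rat.castHom ℂ))) r

/-- At level `m = 1` Kato's character sum is the single value `ι(y)` (local copy). [folklore] -/
private theorem charSum_of_level_one' {m : ℕ} [NeZero m] (hm : m = 1) (ι : CyclotomicField m ℚ →+* ℂ)
    (χ : DirichletCharacter ℂ m) (y : CyclotomicField m ℚ) : charSum m ι χ y = ι y := by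
  subst hm
  haveI : Subsingleton (ZMod 1) := ZMod.subsingleton_iff.mpr rfl
  haveI : Subsingleton (ZMod 1)ˣ := ⟨fun a b ↦ Units.ext (Subsingleton.elim _ _)⟩
  rw [charSum, Fintype.sum_subsingleton _ 1, Units.val_one, map_one, one_mul, sigma, map_one,
    AlgEquiv.one_apply]

/-- A Dirichlet character of level `1` is identically `1` (local copy). [folklore] -/
private theorem dirichletCharacter_apply_of_level_one' {m : ℕ} (hm : m = 1) (χ : DirichletCharacter ℂ m)
    (u : ZMod m) : χ u = 1 := by
  subst hm
  haveI : Subsingleton (ZMod 1) := ZMod.subsingleton_iff.mpr rfl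
  rw [Subsingleton.elim u 1, map_one]

omit [NeZero N] in
/-- **The level-`1` value from (C5) alone**: for Kato-shaped values `x` with the value law (C5) at constant `κ'`, `(cd, A) = 1`, `dd′ ≡ 1 (A)`
and an entire continuation `L` of the `(pA)`-depleted series of the trivial character modulo `m(0, ∅) = 1`, the value `x_{0,∅} = r₀ ∈ ℚ` has
`r₀ = κ'·L(1)/Ω⁺·R⁻_𝟙`. Twin of the value half of `Kato2004.zetaBody_value_level_one` (no `Λ`-clause).
[cite: Kato2004Asterisque, Thm. 6.6 (1) (p. 163), Thm. 9.7 (p. 189)] -/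
theorem value_level_one_of_valueLaw {p : ℕ} [Fact p.Prime] {ι : (m : ℕ) → (CyclotomicField m ℚ →+* ℂ)} {κ' : ℝ}
    {c d a : ℤ} {A : ℕ}
    {x : ∀ (k : ℕ) (r : (cyclotomicLevelsRat p (badPlaces c d A N)).Ideals), CyclotomicField (cycLevel p k r.1) ℚ}
    (hC5 :
      ∀ (k : ℕ) (r : (cyclotomicLevelsRat p (badPlaces c d A N)).Ideals) (d' : ℤ) (χ : DirichletCharacter ℂ (cycLevel p k r.1)) (Lχ : ℂ → ℂ),
        Int.gcd (c * d) (cycLevel p k r.1 * A) = 1 →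
        d * d' ≡ 1 [ZMOD (A : ℤ)] →
        IsDepletedTwistedL f (cycLevel p k r.1) (p * A) χ Lχ →
          (χ (-1) = 1 →
            charSum (cycLevel p k r.1) (ι (cycLevel p k r.1)) χ (x k r) =
              (κ' : ℂ) * (Lχ 1 / (plusPeriod f : ℂ)) *
                cuspFactor f true (fun n ↦ χ⁻¹ (n : ZMod (cycLevel p k r.1))) c d a A d') ∧
          (χ (-1) = -1 →
            charSum (cycLevel p k r.1) (ι (cycLevel p k r.1)) χ (x k r) =
              -(κ' : ℂ) * (Lχ 1 / (Complex.I * (minusPeriod f : ℂ))) *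
                cuspFactor f false (fun n ↦ χ⁻¹ (n : ZMod (cycLevel p k r.1))) c d a A d'))
    (d' : ℤ) (hcd : Int.gcd (c * d) A = 1) (hdd' : d * d' ≡ 1 [ZMOD (A : ℤ)]) {Lχ : ℂ → ℂ}
    (hL : IsDepletedTwistedL f (cycLevel p 0 ∅) (p * A) (1 : DirichletCharacter ℂ (cycLevel p 0 ∅)) Lχ) :
    ∃ r₀ : ℚ, algebraMap ℚ _ r₀ = x 0 (cyclotomicLevelsRat p (badPlaces c d A N)).idealOne ∧
      (r₀ : ℂ) = κ' * (Lχ 1 / (plusPeriod f : ℂ)) * cuspFactor f true (fun _ ↦ 1) c d a A d' := by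
  have h1 : cycLevel p 0 (cyclotomicLevelsRat p (badPlaces c d A N)).idealOne.1 = 1 :=
    cycLevel_zero_empty' p
  obtain ⟨r₀, hr₀⟩ := exists_algebraMap_eq_of_level_one' h1
    (x 0 (cyclotomicLevelsRat p (badPlaces c d A N)).idealOne)
  refine ⟨r₀, hr₀, ?_⟩
  have hgcd : Int.gcd (c * d)
      (cycLevel p 0 (cyclotomicLevelsRat p (badPlaces c d A N)).idealOne.1 * A) = 1 := by
    rw [h1, Nat.cast_one, one_mul]
    exact hcd
  have h5 := (hC5 0 _ d' 1 Lχ hgcd hdd' hL).1 (by rw [MulChar.one_apply (isUnit_one.neg)])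
  have hχ : (fun n : ℤ ↦
      (1 : DirichletCharacter ℂ (cycLevel p 0 (cyclotomicLevelsRat p (badPlaces c d A N)).idealOne.1))⁻¹
        (n : ZMod _)) = fun _ ↦ (1 : ℂ) := by
    funext n
    rw [inv_one]
    exact dirichletCharacter_apply_of_level_one' h1 _ _
  rw [hχ, charSum_of_level_one' h1, ← hr₀, ringHom_algebraMap_ratCast'] at h5
  exact h5

/-- **Kato's constant is rational, from the (C5)-family alone.** Let `f` be the newform of `W/ℚ` with `L(W,1) ≠ 0`, `p` any prime, `ι` any
family of complex embeddings, `κ` a real constant such that for ALL admissible `(c, d, a, A)` (`A ≥ 1`, `(c, 6pA) = 1`, `(d, 6pN) = 1`) there are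
values `x` satisfying Kato's value law (C5) at constant `κ`. Then `κ ∈ ℚ`. Twin of w4 g0's `exists_ratCast_eq_katoConstant` (same proof: Kato's
guarded datum with `R⁻ ≠ 0`, `valueGuard_satisfiable`; the level-`1` value `r₀ = κ·L_{(pA)}(f,1)/Ω⁺·R⁻ ∈ ℚ` with `L_{(pA)}(f,1)/Ω⁺·R⁻ =
P₁·[0]⁺·R⁻ ∈ ℚ ∖ {0}`); no classes, no `Λ`, no Tate-module binders. CONDITIONAL on the displayed (C5)-family.
[cite: Kato2004Asterisque, Thm. 6.6 (1) (p. 163), Thm. 9.7 (p. 189), Ex. 13.3 (p. 225)] [cite: MazurTateTeitelbaum1986Invent, §I.8 (8.6)] -/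
theorem exists_ratCast_eq_katoConstant_of_valueLaw (hf : IsNewformOf W f) (hL1 : W.entireLFunction 1 ≠ 0) (p : ℕ) [Fact p.Prime]
    {ι : (m : ℕ) → (CyclotomicField m ℚ →+* ℂ)} {κ : ℝ}
    (hfam : ∀ (c d a : ℤ) (A : ℕ), 0 < A → Int.gcd c (6 * p * A) = 1 → Int.gcd d (6 * p * N) = 1 →
      ∃ x : ∀ (k : ℕ) (r : (cyclotomicLevelsRat p (badPlaces c d A N)).Ideals), CyclotomicField (cycLevel p k r.1) ℚ,
        ∀ (k : ℕ) (r : (cyclotomicLevelsRat p (badPlaces c d A N)).Ideals) (d' : ℤ) (χ : DirichletCharacter ℂ (cycLevel p k r.1)) (Lχ : ℂ → ℂ),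
          Int.gcd (c * d) (cycLevel p k r.1 * A) = 1 →
          d * d' ≡ 1 [ZMOD (A : ℤ)] →
          IsDepletedTwistedL f (cycLevel p k r.1) (p * A) χ Lχ →
            (χ (-1) = 1 →
              charSum (cycLevel p k r.1) (ι (cycLevel p k r.1)) χ (x k r) =
                (κ : ℂ) * (Lχ 1 / (plusPeriod f : ℂ)) *
                  cuspFactor f true (fun n ↦ χ⁻¹ (n : ZMod (cycLevel p k r.1))) c d a A d') ∧
            (χ (-1) = -1 →
              charSum (cycLevel p k r.1) (ι (cycLevel p k r.1)) χ (x k r) =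
                -(κ : ℂ) * (Lχ 1 / (Complex.I * (minusPeriod f : ℂ))) *
                  cuspFactor f false (fun n ↦ χ⁻¹ (n : ZMod (cycLevel p k r.1))) c d a A d')) :
    ∃ q : ℚ, κ = q := by
  have hp : p.Prime := Fact.out
  obtain ⟨c, d, a, A, d', hA, hc, hd, hcd, hdd', hR⟩ := valueGuard_satisfiable f hf.1 hf.coeffField_eq_bot p
  obtain ⟨x, hC5⟩ := hfam c d a A hA hc hd
  haveI : NeZero A := ⟨hA.ne'⟩
  haveI : NeZero (p * A) := ⟨mul_ne_zero hp.ne_zero hA.ne'⟩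
  -- the continuation of `KatoConstantRational` §1 at `m = cycLevel p 0 ∅ = 1`, `M = pA`
  obtain ⟨L, hL, hL1eq⟩ := exists_isDepletedTwistedL_trivial_one_eq hf
    (show cycLevel p 0 (∅ : Finset (HeightOneSpectrum (𝓞 ℚ))) = 1 by rw [cycLevel, pow_zero, Finset.prod_empty, mul_one]) (p * A)
  obtain ⟨r₀, -, hr₀⟩ := value_level_one_of_valueLaw (f := f) hC5 d' hcd hdd' hL
  -- the Euler factors at `1` are a non-zero rational
  obtain ⟨P₁, hP₁0, hP₁⟩ := exists_ratCast_eq_eulerFactors_one hf ((cycLevel p 0 ∅ * (p * A)).primeFactors)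
    (fun ℓ hℓ ↦ Nat.prime_of_mem_primeFactors hℓ)
  -- `L(W,1) = [0]⁺ Ω⁺`, `Ω⁺ > 0`, `[0]⁺ ≠ 0`
  have hΩ : 0 < plusPeriod f := IsNewform0.plusPeriod_pos_holds hf.1 hf.coeffField_eq_bot
  have hLval : W.entireLFunction 1 = ((ratPlusSymbol f 0 : ℚ) : ℂ) * (plusPeriod f : ℂ) := by
    rw [hf.entireLFunction_one_eq]; push_cast; ring
  have hsym0 : ratPlusSymbol f 0 ≠ 0 := by
    intro h0
    apply hL1
    rw [hLval, h0, Rat.cast_zero, zero_mul]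
  have hRrat : ratCuspFactor f true c d a A d' ≠ 0 := by
    intro h0
    apply hR
    rw [cuspFactor_one_eq_ratCuspFactor, h0, Rat.cast_zero]
  -- `r₀ = κ · X`, `X = P₁ · [0]⁺ · R⁻ ∈ ℚ ∖ {0}`
  set X : ℚ := P₁ * ratPlusSymbol f 0 * ratCuspFactor f true c d a A d' with hX
  have hX0 : X ≠ 0 := mul_ne_zero (mul_ne_zero hP₁0 hsym0) hRrat
  have hkey : (r₀ : ℂ) = (κ : ℂ) * (X : ℂ) := by
    rw [hr₀, hL1eq, hP₁, hLval, cuspFactor_one_eq_ratCuspFactor, hX]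
    have hΩc : (plusPeriod f : ℂ) ≠ 0 := by exact_mod_cast hΩ.ne'
    field_simp
    push_cast
    ring
  refine ⟨r₀ / X, ?_⟩
  have hκc : (κ : ℂ) = ((r₀ / X : ℚ) : ℂ) := by
    have hXc : (X : ℂ) ≠ 0 := by exact_mod_cast hX0
    rw [Rat.cast_div, eq_div_iff hXc, ← hkey]
  have h := congrArg Complex.re hκc
  rw [Complex.ofReal_re] at h
  rw [h, ← Complex.ofReal_ratCast, Complex.ofReal_re]

/-- **Kato's constant is rational on the habitat, from the (C5)-family alone** (`W.analyticRank = 0 ⇒ L(W,1) ≠ 0`). Twin of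
`exists_ratCast_eq_katoConstant_of_analyticRank_eq_zero`. [cite: Kato2004Asterisque, Thm. 6.6 (1) (p. 163), Thm. 9.7 (p. 189)] -/
theorem exists_ratCast_eq_katoConstant_of_analyticRank_eq_zero_of_valueLaw (hf : IsNewformOf W f) (hr : W.analyticRank = 0)
    (p : ℕ) [Fact p.Prime] {ι : (m : ℕ) → (CyclotomicField m ℚ →+* ℂ)} {κ : ℝ}
    (hfam : ∀ (c d a : ℤ) (A : ℕ), 0 < A → Int.gcd c (6 * p * A) = 1 → Int.gcd d (6 * p * N) = 1 →
      ∃ x : ∀ (k : ℕ) (r : (cyclotomicLevelsRat p (badPlaces c d A N)).Ideals), CyclotomicField (cycLevel p k r.1) ℚ,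
        ∀ (k : ℕ) (r : (cyclotomicLevelsRat p (badPlaces c d A N)).Ideals) (d' : ℤ) (χ : DirichletCharacter ℂ (cycLevel p k r.1)) (Lχ : ℂ → ℂ),
          Int.gcd (c * d) (cycLevel p k r.1 * A) = 1 →
          d * d' ≡ 1 [ZMOD (A : ℤ)] →
          IsDepletedTwistedL f (cycLevel p k r.1) (p * A) χ Lχ →
            (χ (-1) = 1 →
              charSum (cycLevel p k r.1) (ι (cycLevel p k r.1)) χ (x k r) =
                (κ : ℂ) * (Lχ 1 / (plusPeriod f : ℂ)) *
                  cuspFactor f true (fun n ↦ χ⁻¹ (n : ZMod (cycLevel p k r.1))) c d a A d') ∧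
            (χ (-1) = -1 →
              charSum (cycLevel p k r.1) (ι (cycLevel p k r.1)) χ (x k r) =
                -(κ : ℂ) * (Lχ 1 / (Complex.I * (minusPeriod f : ℂ))) *
                  cuspFactor f false (fun n ↦ χ⁻¹ (n : ZMod (cycLevel p k r.1))) c d a A d')) :
    ∃ q : ℚ, κ = q :=
  exists_ratCast_eq_katoConstant_of_valueLaw hf
    ((WeierstrassCurve.analyticRank_eq_zero_iff_holds (W := W) hf.hasEntireLFunction).mp hr) p hfam

end Summit.BirchSwinnertonDyer.BirchSwinnertonDyer.Theorems.SignedKatoOffTwo.KatoConst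

namespace Summit.BirchSwinnertonDyer.BirchSwinnertonDyer.Theorems.SignedKatoOffTwo.KatoValue

variable {W : WeierstrassCurve ℚ} [W.IsElliptic] {N : ℕ} [NeZero N] {f : CuspForm (Gamma0 N) 2}

/-! ## §2 Brick B4c (trivial-character values at `p`-power levels) — from (C5) alone -/

/-- **Kato's trivial-character value at a `p`-power level, in `F = ℚ(ζ_{p^k})`, from (C5) alone.** For Kato-shaped values `x` with the value law
(C5) at constant `κ = q ∈ ℚ`, `A = p^e`, `k ≥ 1`, guards `(cd, p^k·A) = 1`, `dd′ ≡ 1 (A)`: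
`Σ_{b ∈ (ℤ/p^k)ˣ} σ_b(x_{k,∅}) = q · P_p(p⁻¹) · [0]⁺_f · R⁻_𝟙` in `F` (image of a rational). Twin of w4 g0's `sum_sigma_eq_of_zetaBody` (same proof; no
classes, no `Λ`, no Tate-module binders; any `ι`). CONDITIONAL on the displayed (C5).
[cite: Kato2004Asterisque, Thm. 6.6 (1) (p. 163), Thm. 9.7 (p. 189), §6.2 (p. 161)] [cite: MazurTateTeitelbaum1986Invent, §I.8 (8.6)] -/
theorem sum_sigma_eq_of_valueLaw (hf : IsNewformOf W f) (p : ℕ) [Fact p.Prime]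
    {ι : (m : ℕ) → (CyclotomicField m ℚ →+* ℂ)} {κ : ℝ} {c d a : ℤ} {A : ℕ}
    {x : ∀ (k : ℕ) (r : (cyclotomicLevelsRat p (badPlaces c d A N)).Ideals), CyclotomicField (cycLevel p k r.1) ℚ}
    (hC5 :
      ∀ (k : ℕ) (r : (cyclotomicLevelsRat p (badPlaces c d A N)).Ideals) (d' : ℤ) (χ : DirichletCharacter ℂ (cycLevel p k r.1)) (Lχ : ℂ → ℂ),
        Int.gcd (c * d) (cycLevel p k r.1 * A) = 1 →
        d * d' ≡ 1 [ZMOD (A : ℤ)] →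
        IsDepletedTwistedL f (cycLevel p k r.1) (p * A) χ Lχ →
          (χ (-1) = 1 →
            charSum (cycLevel p k r.1) (ι (cycLevel p k r.1)) χ (x k r) =
              (κ : ℂ) * (Lχ 1 / (plusPeriod f : ℂ)) *
                cuspFactor f true (fun n ↦ χ⁻¹ (n : ZMod (cycLevel p k r.1))) c d a A d') ∧
          (χ (-1) = -1 →
            charSum (cycLevel p k r.1) (ι (cycLevel p k r.1)) χ (x k r) =
              -(κ : ℂ) * (Lχ 1 / (Complex.I * (minusPeriod f : ℂ))) *
                cuspFactor f false (fun n ↦ χ⁻¹ (n : ZMod (cycLevel p k r.1))) c d a A d'))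
    {q : ℚ} (hκ : κ = q) {k e : ℕ} (hk : 1 ≤ k) (hA : A = p ^ e) (d' : ℤ)
    (hcd : Int.gcd (c * d) (cycLevel p k (∅ : Finset (HeightOneSpectrum (𝓞 ℚ))) * A) = 1)
    (hdd' : d * d' ≡ 1 [ZMOD (A : ℤ)]) :
    ∑ b : (ZMod (cycLevel p k (∅ : Finset (HeightOneSpectrum (𝓞 ℚ)))))ˣ,
        sigma (cycLevel p k (∅ : Finset (HeightOneSpectrum (𝓞 ℚ)))) b (x k (cyclotomicLevelsRat p (badPlaces c d A N)).idealOne) =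
      algebraMap ℚ (CyclotomicField (cycLevel p k (∅ : Finset (HeightOneSpectrum (𝓞 ℚ)))) ℚ)
        (q * eulerFactorAtOne W N p * ratPlusSymbol f 0 * ratCuspFactor f true c d a A d') := by
  have hp : p.Prime := Fact.out
  have hm : cycLevel p k (∅ : Finset (HeightOneSpectrum (𝓞 ℚ))) = p ^ k := by
    rw [cycLevel, Finset.prod_empty, mul_one]
  haveI : NeZero A := ⟨by rw [hA]; exact pow_ne_zero _ hp.ne_zero⟩
  haveI : NeZero (p * A) := ⟨mul_ne_zero hp.ne_zero (NeZero.ne A)⟩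
  -- the continuation of `KatoTrivialCharValues` §1 and its value
  obtain ⟨L, hL, hL1eq⟩ := exists_isDepletedTwistedL_one_eq hf (cycLevel p k (∅ : Finset (HeightOneSpectrum (𝓞 ℚ)))) (p * A)
  have hprod : cycLevel p k (∅ : Finset (HeightOneSpectrum (𝓞 ℚ))) * (p * A) = p ^ (k + 1 + e) := by
    rw [hm, hA]; ring
  rw [hprod, eulerFactors_prime_pow_eq hf p (by omega : k + 1 + e ≠ 0)] at hL1eq
  -- units modulo `m` from the guard
  obtain ⟨hc, hd⟩ := isUnit_intCast_of_gcd_mul_eq_one (m := cycLevel p k (∅ : Finset (HeightOneSpectrum (𝓞 ℚ)))) (A := A) hcd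
  -- Kato (C5) at the trivial character
  have hK : charSum (cycLevel p k (∅ : Finset (HeightOneSpectrum (𝓞 ℚ)))) (ι (cycLevel p k (∅ : Finset (HeightOneSpectrum (𝓞 ℚ)))))
      1 (x k (cyclotomicLevelsRat p (badPlaces c d A N)).idealOne) =
      κ * (L 1 / (plusPeriod f : ℂ)) *
        cuspFactor f true (fun n ↦ (1 : DirichletCharacter ℂ _)⁻¹ (n : ZMod (cycLevel p k (∅ : Finset (HeightOneSpectrum (𝓞 ℚ))))))
          c d a A d' :=
    (hC5 k (cyclotomicLevelsRat p (badPlaces c d A N)).idealOne d' 1 L hcd hdd' hL).1 (MulChar.one_apply (isUnit_one.neg))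
  -- `L(W,1) = [0]⁺ Ω⁺`, `Ω⁺ ≠ 0`
  have hΩ : (plusPeriod f : ℂ) ≠ 0 := by
    exact_mod_cast (IsNewform0.plusPeriod_pos_holds hf.1 hf.coeffField_eq_bot).ne'
  have hLval : W.entireLFunction 1 = ((ratPlusSymbol f 0 : ℚ) : ℂ) * (plusPeriod f : ℂ) := by
    rw [hf.entireLFunction_one_eq]; push_cast; ring
  -- the character sum is `ι (Σ_b σ_b x)`
  have hcs : charSum (cycLevel p k (∅ : Finset (HeightOneSpectrum (𝓞 ℚ)))) (ι (cycLevel p k (∅ : Finset (HeightOneSpectrum (𝓞 ℚ)))))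
      1 (x k (cyclotomicLevelsRat p (badPlaces c d A N)).idealOne) =
      ι (cycLevel p k (∅ : Finset (HeightOneSpectrum (𝓞 ℚ)))) (∑ b : (ZMod (cycLevel p k (∅ : Finset (HeightOneSpectrum (𝓞 ℚ)))))ˣ,
        sigma (cycLevel p k (∅ : Finset (HeightOneSpectrum (𝓞 ℚ)))) b (x k (cyclotomicLevelsRat p (badPlaces c d A N)).idealOne)) := by
    rw [charSum, map_sum]
    refine Finset.sum_congr rfl fun b _ ↦ ?_
    rw [MulChar.one_apply (Units.isUnit b), one_mul]
  apply (ι (cycLevel p k (∅ : Finset (HeightOneSpectrum (𝓞 ℚ))))).injective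
  rw [← hcs, hK, hL1eq, hLval, cuspFactor_inv_one_eq_ratCuspFactor c d a A d' hc hd, hκ, RingHom.map_rat_algebraMap,
    eq_ratCast, Complex.ofReal_ratCast]
  push_cast
  field_simp

end Summit.BirchSwinnertonDyer.BirchSwinnertonDyer.Theorems.SignedKatoOffTwo.KatoValue


namespace Summit.BirchSwinnertonDyer.BirchSwinnertonDyer.Theorems.SignedKatoOffTwo.KatoBK

/-! ## §3 The socket-shaped brick B4c over (C5) alone (levels `4, 8`) -/

/-- **Brick B4c (Kato's trivial-character values at levels `4, 8`) in the socket shape, from (C5) alone** (twin of `katoTrivialValuesTwo_brick`: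
`KatoValue.sum_sigma_eq_of_valueLaw` with `eulerFactorAtOne W N 2 = 3/2` from `a₂(W) = 0`, `2 ∤ N`). [cite: Kato2004Asterisque, Thm. 6.6 (1), Thm. 9.7] -/
theorem katoTrivialValuesTwo_brick_of_valueLaw :
    ∀ (W : WeierstrassCurve ℚ) [W.IsElliptic] [W.IsGloballyMinimal], GoodSS W 2 → W.frobeniusTrace 2 = 0 →
    ∀ [NeZero (W.conductorNorm ℤ)] (f : CuspForm (Gamma0 (W.conductorNorm ℤ)) 2), IsNewformOf W f →
    ∀ {ιC : (m : ℕ) → (CyclotomicField m ℚ →+* ℂ)} {κK : ℝ} {c d a : ℤ} {A : ℕ}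
    {x : ∀ (k : ℕ) (r : (cyclotomicLevelsRat 2 (badPlaces c d A (W.conductorNorm ℤ))).Ideals),
      CyclotomicField (cycLevel 2 k r.1) ℚ},
    (∀ (k : ℕ) (r : (cyclotomicLevelsRat 2 (badPlaces c d A (W.conductorNorm ℤ))).Ideals) (d' : ℤ) (χ : DirichletCharacter ℂ (cycLevel 2 k r.1)) (Lχ : ℂ → ℂ),
      Int.gcd (c * d) (cycLevel 2 k r.1 * A) = 1 →
      d * d' ≡ 1 [ZMOD (A : ℤ)] →
      IsDepletedTwistedL f (cycLevel 2 k r.1) (2 * A) χ Lχ →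
        (χ (-1) = 1 →
          charSum (cycLevel 2 k r.1) (ιC (cycLevel 2 k r.1)) χ (x k r) =
            (κK : ℂ) * (Lχ 1 / (plusPeriod f : ℂ)) *
              cuspFactor f true (fun n ↦ χ⁻¹ (n : ZMod (cycLevel 2 k r.1))) c d a A d') ∧
        (χ (-1) = -1 →
          charSum (cycLevel 2 k r.1) (ιC (cycLevel 2 k r.1)) χ (x k r) =
            -(κK : ℂ) * (Lχ 1 / (Complex.I * (minusPeriod f : ℂ))) *
              cuspFactor f false (fun n ↦ χ⁻¹ (n : ZMod (cycLevel 2 k r.1))) c d a A d')) →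
    ∀ {q : ℚ}, κK = q → ∀ {ee : ℕ}, A = 2 ^ ee → ∀ (d' : ℤ), d * d' ≡ 1 [ZMOD (A : ℤ)] →
    ∀ (k : ℕ), 2 ≤ k → k ≤ 3 → Int.gcd (c * d) (cycLevel 2 k (∅ : Finset (HeightOneSpectrum (𝓞 ℚ))) * A) = 1 →
    ∑ b : (ZMod (cycLevel 2 k (∅ : Finset (HeightOneSpectrum (𝓞 ℚ)))))ˣ,
        sigma (cycLevel 2 k (∅ : Finset (HeightOneSpectrum (𝓞 ℚ)))) b
          (x k (cyclotomicLevelsRat 2 (badPlaces c d A (W.conductorNorm ℤ))).idealOne) =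
      ((3 / 2 * q * ratPlusSymbol f 0 *
          (c ^ 2 * d ^ 2 * ratMinusSymbol f ((a : ℚ) / A) - c * d ^ 2 * ratMinusSymbol f ((a * c : ℚ) / A)
            - c ^ 2 * d * ratMinusSymbol f ((a * d' : ℚ) / A) + c * d * ratMinusSymbol f ((a * c * d' : ℚ) / A)) : ℚ) :
        CyclotomicField (cycLevel 2 k (∅ : Finset (HeightOneSpectrum (𝓞 ℚ)))) ℚ) := by
  intro W _ _ hss ha _ f hf ιC κK c d a A x hC5 q hq ee hA d' hdd' k hk2 hk3 hcd
  have hN2 : ¬ 2 ∣ W.conductorNorm ℤ := not_dvd_level_of_isNewformOf hf hss.1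
  have hL2 : W.LFunction 2 = 0 := by rw [LFunction_apply_prime_eq_frobeniusTrace W 2 hss.1, ha]
  have h := KatoValue.sum_sigma_eq_of_valueLaw hf 2 hC5 hq (by omega : 1 ≤ k) hA d' hcd hdd'
  rw [h, KatoValue.eulerFactorAtOne_two_eq hL2 hN2, eq_ratCast, ratCuspFactor]
  congr 1
  simp only [↓reduceIte, hA]
  push_cast
  ring

end Summit.BirchSwinnertonDyer.BirchSwinnertonDyer.Theorems.SignedKatoOffTwo.KatoBK


end
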